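import Mathlib
import Literature.Analysis.FluidPDE.Tao2016AveragedNS.ShiftSetCascadeFlows
import Literature.Analysis.ODE.GlobalExistence
import Summits.NavierStokesRegularity.NavierStokesRegularity.Theorems.TaoLadderRungTwoFlatMirrorTableDefs
import Summits.NavierStokesRegularity.NavierStokesRegularity.Theorems.TaoLadderRungTwoFlatQuadPolarOn
import Summits.NavierStokesRegularity.NavierStokesRegularity.Theorems.TaoLadderRungTwoFlatPulseDefs
import Summits.NavierStokesRegularity.NavierStokesRegularity.Theorems.TaoLadderRungTwoFlatPulseFlows
import Summits.NavierStokesRegularity.NavierStokesRegularity.Theorems.TaoLadderRungTwoFlatLinearisedUniqueness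
import HarnessLib

/-!
# EXISTENCE of bounded solutions of the linearised homogeneous lattice equation from bounded data
  (any shift set, scale ratio 1; the well-posedness half complementing `…LinearisedUniqueness`)
  (helper for item stmt-NavierStokesRegularity-22987 `FlatGapCertificatesV2`, crux K_A♭ of route
  TaoLadderRungTwoFlat; cell harvest/h2-tao-ladder, p1 g19)

The variational equation `u̇ = Lin_Φ(u)` along a bounded background `Φ` that is uniformly Lipschitz in time is a
LINEAR ODE in the Banach space `(Fin m × ℤ) →ᵇ ℝ` (sup norm over all sites) with a bounded, time-continuous
operator: `linField`. Global existence forward and backward in time (tree: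
`Literature.Analysis.ODE.exists_solution_Ici_of_apriori_bound`, a priori bound by Grönwall) gives, for every
bounded datum `v`, a GLOBAL solution bounded on compact time intervals:

* `linField` (+ bounds), `exists_forward`, `exists_linearised_solution` — **for bounded `v` there is `u` with
  `u(0) = v`, `HasDerivAt (u i n) (Lin_Φ(u)_{i,n}(t)) t` at EVERY `t`, `|u| ≤ B·exp(2‖α‖₁M T)` on `[−T,T]`**;
* `MirrorPulse.exists_isVariationalOn` — the solution operator behind (S2) exists (all horizons `T`).

HONEST FRAMING: standard ODE theory for a MODEL lattice; nothing certified; nothing about the Navier–Stokes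
equations.
-/

noncomputable section

-- the sub-problem namespace repeats the summit name by design (D-0017)
set_option linter.dupNamespace false

namespace Summit.NavierStokesRegularity.NavierStokesRegularity.Theorems

open Set Filter Metric Literature.Analysis.FluidPDE Literature.Analysis.FluidPDE.TaoCascade
open scoped Topology NNReal BoundedContinuousFunction

namespace QuadPolar

variable {m : ℕ}

/-! ### The linearised field on the Banach space of bounded families -/

/-- A bounded function on `Fin m × ℤ` read as a (time-constant) family. [folklore] -/
def famOf (U : Fin m × ℤ →ᵇ ℝ) : Fin m → ℤ → ℝ → ℝ := fun j k _ => U (j, k)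

/-- Coordinates are bounded by the norm. [folklore] -/
theorem abs_famOf_le (U : Fin m × ℤ →ᵇ ℝ) (j : Fin m) (k : ℤ) (t : ℝ) : |famOf U j k t| ≤ ‖U‖ := by
  unfold famOf
  exact (Real.norm_eq_abs _).symm.le.trans (U.norm_coe_le_norm (j, k))

/-- The components of the linearised field at time `t`: `(i,k) ↦ Lin_{Φ(t)}(U)_{i,k}`. [cite: Tao2016AveragedNS, §4 (4.8)] -/
def linFieldFun (𝕊 : Finset (ℤ × ℤ × ℤ)) (α : Fin m → Fin m → Fin m → ℤ × ℤ × ℤ → ℝ)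
    (Φ : Fin m → ℤ → ℝ → ℝ) (t : ℝ) (U : Fin m × ℤ →ᵇ ℝ) : Fin m × ℤ → ℝ :=
  fun p => linTermOn 𝕊 0 α Φ (famOf U) p.1 p.2 t

/-- Bound of the components: `|Lin_{Φ(t)}(U)_{i,k}| ≤ 2‖α‖₁ M ‖U‖` for `|Φ| ≤ M`. [cite: Tao2016AveragedNS, §4 (4.8)] -/
theorem abs_linFieldFun_le (𝕊 : Finset (ℤ × ℤ × ℤ)) (α : Fin m → Fin m → Fin m → ℤ × ℤ × ℤ → ℝ)
    {Φ : Fin m → ℤ → ℝ → ℝ} {M : ℝ} (hΦ : ∀ j k t, |Φ j k t| ≤ M) (t : ℝ) (U : Fin m × ℤ →ᵇ ℝ)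
    (p : Fin m × ℤ) : |linFieldFun 𝕊 α Φ t U p| ≤ 2 * tableAbsSum 𝕊 α * M * ‖U‖ :=
  abs_linTermOn_zero_le 𝕊 α (fun j k => hΦ j k t) (fun j k => abs_famOf_le U j k t) p.1 p.2

/-- **The linearised field as a vector field on `(Fin m × ℤ) →ᵇ ℝ`.** [cite: Tao2016AveragedNS, §4 (4.8)] -/
def linField (𝕊 : Finset (ℤ × ℤ × ℤ)) (α : Fin m → Fin m → Fin m → ℤ × ℤ × ℤ → ℝ)
    {Φ : Fin m → ℤ → ℝ → ℝ} {M : ℝ} (hΦ : ∀ j k t, |Φ j k t| ≤ M) (t : ℝ) (U : Fin m × ℤ →ᵇ ℝ) :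
    Fin m × ℤ →ᵇ ℝ :=
  BoundedContinuousFunction.ofNormedAddCommGroupDiscrete (linFieldFun 𝕊 α Φ t U)
    (2 * tableAbsSum 𝕊 α * M * ‖U‖) fun p => (Real.norm_eq_abs _).trans_le (abs_linFieldFun_le 𝕊 α hΦ t U p)

/-- Components of `linField`. [cite: Tao2016AveragedNS, §4 (4.8)] -/
theorem linField_apply (𝕊 : Finset (ℤ × ℤ × ℤ)) (α : Fin m → Fin m → Fin m → ℤ × ℤ × ℤ → ℝ)
    {Φ : Fin m → ℤ → ℝ → ℝ} {M : ℝ} (hΦ : ∀ j k t, |Φ j k t| ≤ M) (t : ℝ) (U : Fin m × ℤ →ᵇ ℝ)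
    (i : Fin m) (k : ℤ) : linField 𝕊 α hΦ t U (i, k) = linTermOn 𝕊 0 α Φ (famOf U) i k t := rfl

/-- Norm bound `‖linField t U‖ ≤ 2‖α‖₁ M ‖U‖` (`M ≥ 0`). [cite: Tao2016AveragedNS, §4 (4.8)] -/
theorem norm_linField_le (𝕊 : Finset (ℤ × ℤ × ℤ)) (α : Fin m → Fin m → Fin m → ℤ × ℤ × ℤ → ℝ)
    {Φ : Fin m → ℤ → ℝ → ℝ} {M : ℝ} (hΦ : ∀ j k t, |Φ j k t| ≤ M) (hM : 0 ≤ M) (t : ℝ)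
    (U : Fin m × ℤ →ᵇ ℝ) : ‖linField 𝕊 α hΦ t U‖ ≤ 2 * tableAbsSum 𝕊 α * M * ‖U‖ := by
  have hC : 0 ≤ 2 * tableAbsSum 𝕊 α * M * ‖U‖ := by
    have := tableAbsSum_nonneg 𝕊 α; positivity
  exact (BoundedContinuousFunction.norm_le hC).2 fun p =>
    (Real.norm_eq_abs _).trans_le (abs_linFieldFun_le 𝕊 α hΦ t U p)

/-- The field is linear in `U`: differences. [cite: Tao2016AveragedNS, §4 (4.8)] -/
theorem linField_sub (𝕊 : Finset (ℤ × ℤ × ℤ)) (α : Fin m → Fin m → Fin m → ℤ × ℤ × ℤ → ℝ)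
    {Φ : Fin m → ℤ → ℝ → ℝ} {M : ℝ} (hΦ : ∀ j k t, |Φ j k t| ≤ M) (t : ℝ) (U V : Fin m × ℤ →ᵇ ℝ) :
    linField 𝕊 α hΦ t U - linField 𝕊 α hΦ t V = linField 𝕊 α hΦ t (U - V) := by
  ext ⟨i, k⟩
  simp only [BoundedContinuousFunction.coe_sub, Pi.sub_apply, linField_apply]
  have e : famOf (U - V) = famOf U + (-1 : ℝ) • famOf V := by
    funext j l s; simp [famOf]; ring
  rw [e, linTermOn_add, linTermOn_smul]
  ring

/-- **Global Lipschitz bound in `U`**: `‖linField t U − linField t V‖ ≤ 2‖α‖₁M ‖U − V‖`.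
[cite: Tao2016AveragedNS, §4 (4.8)] -/
theorem lipschitzWith_linField (𝕊 : Finset (ℤ × ℤ × ℤ)) (α : Fin m → Fin m → Fin m → ℤ × ℤ × ℤ → ℝ)
    {Φ : Fin m → ℤ → ℝ → ℝ} {M : ℝ} (hΦ : ∀ j k t, |Φ j k t| ≤ M) (hM : 0 ≤ M) (t : ℝ) :
    LipschitzWith (Real.toNNReal (2 * tableAbsSum 𝕊 α * M)) (linField 𝕊 α hΦ t) := by
  refine LipschitzWith.of_dist_le_mul fun U V => ?_
  have hK : 0 ≤ 2 * tableAbsSum 𝕊 α * M := by have := tableAbsSum_nonneg 𝕊 α; positivity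
  rw [Real.coe_toNNReal _ hK, dist_eq_norm, dist_eq_norm, linField_sub]
  exact norm_linField_le 𝕊 α hΦ hM t (U - V)

/-- The linearisation is linear in the BACKGROUND: `Lin_Φ(u) − Lin_Ψ(u) = Lin_{Φ−Ψ}(u)`.
[cite: Tao2016AveragedNS, §4 (4.8)] -/
theorem linTermOn_sub_background (𝕊 : Finset (ℤ × ℤ × ℤ)) (ε₀ : ℝ)
    (α : Fin m → Fin m → Fin m → ℤ × ℤ × ℤ → ℝ) (Φ Ψ u : Fin m → ℤ → ℝ → ℝ) (i : Fin m) (n : ℤ) (t : ℝ) :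
    linTermOn 𝕊 ε₀ α Φ u i n t - linTermOn 𝕊 ε₀ α Ψ u i n t = linTermOn 𝕊 ε₀ α (Φ - Ψ) u i n t := by
  have e : Φ - Ψ = Φ + (-1 : ℝ) • Ψ := by funext j l s; simp; ring
  rw [e]
  simp only [linTermOn, bilinOn_add_left, bilinOn_add_right, bilinOn_smul_left, bilinOn_smul_right]
  ring

/-- **Time continuity of the field**: if the background is uniformly `Λ`-Lipschitz in time at every site,
`‖linField t U − linField s U‖ ≤ 2‖α‖₁ Λ |t − s| ‖U‖`. [cite: Tao2016AveragedNS, §4 (4.8)] -/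
theorem norm_linField_sub_time_le (𝕊 : Finset (ℤ × ℤ × ℤ)) (α : Fin m → Fin m → Fin m → ℤ × ℤ × ℤ → ℝ)
    {Φ : Fin m → ℤ → ℝ → ℝ} {M Λ : ℝ} (hΦ : ∀ j k t, |Φ j k t| ≤ M) (hΛ : 0 ≤ Λ)
    (hlip : ∀ j k t s, |Φ j k t - Φ j k s| ≤ Λ * |t - s|) (t s : ℝ) (U : Fin m × ℤ →ᵇ ℝ) :
    ‖linField 𝕊 α hΦ t U - linField 𝕊 α hΦ s U‖ ≤ 2 * tableAbsSum 𝕊 α * (Λ * |t - s|) * ‖U‖ := by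
  have hC : 0 ≤ 2 * tableAbsSum 𝕊 α * (Λ * |t - s|) * ‖U‖ := by
    have := tableAbsSum_nonneg 𝕊 α; positivity
  refine (BoundedContinuousFunction.norm_le hC).2 fun p => ?_
  obtain ⟨i, k⟩ := p
  rw [BoundedContinuousFunction.coe_sub, Pi.sub_apply, linField_apply, linField_apply, Real.norm_eq_abs]
  set Φt : Fin m → ℤ → ℝ → ℝ := fun j l _ => Φ j l t with hΦt
  set Φs : Fin m → ℤ → ℝ → ℝ := fun j l _ => Φ j l s with hΦs
  have e1 : linTermOn 𝕊 0 α Φ (famOf U) i k t = linTermOn 𝕊 0 α Φt (famOf U) i k 0 := by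
    unfold linTermOn
    rw [MirrorPulse.bilinOn_congr_time 𝕊 0 α (X := Φ) (X' := fun j l _ => Φ j l t) (Y := famOf U)
        (Y' := famOf U) (t := t) (fun _ _ => rfl) (fun _ _ => rfl) i k,
      MirrorPulse.bilinOn_congr_time 𝕊 0 α (X := famOf U) (X' := famOf U) (Y := Φ)
        (Y' := fun j l _ => Φ j l t) (t := t) (fun _ _ => rfl) (fun _ _ => rfl) i k]
    rfl
  have e2 : linTermOn 𝕊 0 α Φ (famOf U) i k s = linTermOn 𝕊 0 α Φs (famOf U) i k 0 := by
    unfold linTermOn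
    rw [MirrorPulse.bilinOn_congr_time 𝕊 0 α (X := Φ) (X' := fun j l _ => Φ j l s) (Y := famOf U)
        (Y' := famOf U) (t := s) (fun _ _ => rfl) (fun _ _ => rfl) i k,
      MirrorPulse.bilinOn_congr_time 𝕊 0 α (X := famOf U) (X' := famOf U) (Y := Φ)
        (Y' := fun j l _ => Φ j l s) (t := s) (fun _ _ => rfl) (fun _ _ => rfl) i k]
    rfl
  rw [e1, e2, linTermOn_sub_background]
  have hb := abs_linTermOn_zero_le 𝕊 α (Φ := Φt - Φs) (u := famOf U) (MΦ := Λ * |t - s|) (Mu := ‖U‖)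
    (t := 0) (fun j l => by simp [hΦt, hΦs, hlip j l t s]) (fun j l => abs_famOf_le U j l 0) i k
  linarith

/-! ### Global existence in the Banach space -/

/-- Continuity in time of the field at a fixed state. [folklore] -/
theorem continuous_linField_time (𝕊 : Finset (ℤ × ℤ × ℤ)) (α : Fin m → Fin m → Fin m → ℤ × ℤ × ℤ → ℝ)
    {Φ : Fin m → ℤ → ℝ → ℝ} {M Λ : ℝ} (hΦ : ∀ j k t, |Φ j k t| ≤ M) (hΛ : 0 ≤ Λ)
    (hlip : ∀ j k t s, |Φ j k t - Φ j k s| ≤ Λ * |t - s|) (U : Fin m × ℤ →ᵇ ℝ) :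
    Continuous fun t => linField 𝕊 α hΦ t U := by
  refine Metric.continuous_iff.2 fun t ε hε => ?_
  have hA := tableAbsSum_nonneg 𝕊 α
  refine ⟨ε / (2 * tableAbsSum 𝕊 α * Λ * ‖U‖ + 1), div_pos hε (by positivity), fun s hs => ?_⟩
  rw [dist_eq_norm]
  have h := norm_linField_sub_time_le 𝕊 α hΦ hΛ hlip s t U
  have hst : |s - t| < ε / (2 * tableAbsSum 𝕊 α * Λ * ‖U‖ + 1) := by rwa [Real.dist_eq] at hs
  have hK : 0 ≤ 2 * tableAbsSum 𝕊 α * Λ * ‖U‖ := by positivity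
  calc ‖linField 𝕊 α hΦ s U - linField 𝕊 α hΦ t U‖ ≤ 2 * tableAbsSum 𝕊 α * (Λ * |s - t|) * ‖U‖ := h
    _ = (2 * tableAbsSum 𝕊 α * Λ * ‖U‖) * |s - t| := by ring
    _ ≤ (2 * tableAbsSum 𝕊 α * Λ * ‖U‖) * (ε / (2 * tableAbsSum 𝕊 α * Λ * ‖U‖ + 1)) :=
        mul_le_mul_of_nonneg_left hst.le hK
    _ < ε := by
        rw [mul_div_assoc']
        rw [div_lt_iff₀ (by positivity)]
        nlinarith

/-- **Forward global solution** of `U̇ = linField t U` in `(Fin m × ℤ) →ᵇ ℝ` from any datum, with the Grönwall bound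
`‖U t‖ ≤ ‖U₀‖ exp(2‖α‖₁M t)`. [cite: Teschl2012, Cor. 2.16; folklore] -/
theorem exists_forward (𝕊 : Finset (ℤ × ℤ × ℤ)) (α : Fin m → Fin m → Fin m → ℤ × ℤ × ℤ → ℝ)
    {Φ : Fin m → ℤ → ℝ → ℝ} {M Λ : ℝ} (hΦ : ∀ j k t, |Φ j k t| ≤ M) (hM : 0 ≤ M) (hΛ : 0 ≤ Λ)
    (hlip : ∀ j k t s, |Φ j k t - Φ j k s| ≤ Λ * |t - s|) (U₀ : Fin m × ℤ →ᵇ ℝ) :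
    ∃ U : ℝ → (Fin m × ℤ →ᵇ ℝ), U 0 = U₀ ∧ ContinuousOn U (Ici 0) ∧
      (∀ t, 0 ≤ t → HasDerivWithinAt U (linField 𝕊 α hΦ t (U t)) (Ici 0) t) ∧
      (∀ t, 0 < t → HasDerivAt U (linField 𝕊 α hΦ t (U t)) t) ∧
      ∀ t, 0 ≤ t → ‖U t‖ ≤ ‖U₀‖ * Real.exp (2 * tableAbsSum 𝕊 α * M * t) := by
  set L : ℝ := 2 * tableAbsSum 𝕊 α * M with hL
  have hL0 : 0 ≤ L := by rw [hL]; have := tableAbsSum_nonneg 𝕊 α; positivity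
  have hgron : ∀ s : ℝ, ∀ β : ℝ → (Fin m × ℤ →ᵇ ℝ), β 0 = U₀ →
      (∀ t ∈ Icc 0 s, HasDerivWithinAt β (linField 𝕊 α hΦ t (β t)) (Icc 0 s) t) →
      ∀ t ∈ Icc 0 s, ‖β t‖ ≤ ‖U₀‖ * Real.exp (L * t) := by
    intro s β hβ0 hβ t ht
    have hcont : ContinuousOn β (Icc 0 s) := fun x hx => (hβ x hx).continuousWithinAt
    have hder : ∀ x ∈ Ico 0 s, HasDerivWithinAt β (linField 𝕊 α hΦ x (β x)) (Ici x) x := by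
      intro x hx
      exact (hβ x ⟨hx.1, hx.2.le⟩).mono_of_mem_nhdsWithin
        (Filter.mem_of_superset (inter_mem_nhdsWithin (Ici x) (Iio_mem_nhds hx.2))
          fun y hy => ⟨hx.1.trans hy.1, hy.2.le⟩)
    have hbound : ∀ x ∈ Ico 0 s, ‖linField 𝕊 α hΦ x (β x)‖ ≤ L * ‖β x‖ + 0 := fun x _ => by
      rw [add_zero, hL]; exact norm_linField_le 𝕊 α hΦ hM x (β x)
    have h := norm_le_gronwallBound_of_norm_deriv_right_le hcont hder (by rw [hβ0]) hbound t ht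
    rwa [gronwallBound_ε0, sub_zero] at h
  have hR0 : ∀ T : ℝ, 0 ≤ T → ‖U₀‖ ≤ ‖U₀‖ * Real.exp (L * T) := fun T hT => by
    have : 1 ≤ Real.exp (L * T) := Real.one_le_exp (by positivity)
    nlinarith [norm_nonneg U₀]
  have hapr : ∀ T : ℝ, 0 ≤ T → ∀ s ∈ Icc 0 T, ∀ β : ℝ → (Fin m × ℤ →ᵇ ℝ), β 0 = U₀ →
      (∀ t ∈ Icc 0 s, HasDerivWithinAt β (linField 𝕊 α hΦ t (β t)) (Icc 0 s) t) →
      ∀ t ∈ Icc 0 s, ‖β t‖ ≤ ‖U₀‖ * Real.exp (L * T) := by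
    intro T hT s hs β hβ0 hβ t ht
    have h := hgron s β hβ0 hβ t ht
    have hmono : Real.exp (L * t) ≤ Real.exp (L * T) := Real.exp_le_exp.2 (by nlinarith [ht.2, hs.2])
    exact h.trans (mul_le_mul_of_nonneg_left hmono (norm_nonneg _))
  obtain ⟨U, hU0, hUc, hUw, hUd⟩ := Literature.Analysis.ODE.exists_solution_Ici_of_apriori_bound
    (v := fun t x => linField 𝕊 α hΦ t x) (x₀ := U₀)
    (fun T ρ => ⟨Real.toNNReal L, fun t _ => (lipschitzWith_linField 𝕊 α hΦ hM t).lipschitzOnWith⟩)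
    (fun x => (continuous_linField_time 𝕊 α hΦ hΛ hlip x).continuousOn)
    (fun T hT => ⟨‖U₀‖ * Real.exp (L * T), hR0 T hT, hapr T hT⟩)
  refine ⟨U, hU0, hUc, hUw, hUd, fun t ht => ?_⟩
  have hsol : ∀ x ∈ Icc 0 t, HasDerivWithinAt U (linField 𝕊 α hΦ x (U x)) (Icc 0 t) x :=
    fun x hx => (hUw x hx.1).mono Icc_subset_Ici_self
  exact hgron t U hU0 hsol t ⟨ht, le_rfl⟩

/-! ### Backward continuation, gluing, and the coordinate family -/

/-- Time composition for the polarisation (definitional). [cite: Tao2016AveragedNS, §4 (4.8)] -/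
theorem bilinOn_comp_time (𝕊 : Finset (ℤ × ℤ × ℤ)) (ε₀ : ℝ) (α : Fin m → Fin m → Fin m → ℤ × ℤ × ℤ → ℝ)
    (X Y : Fin m → ℤ → ℝ → ℝ) (φ : ℝ → ℝ) (i : Fin m) (n : ℤ) (t : ℝ) :
    bilinOn 𝕊 ε₀ α (fun j k s => X j k (φ s)) (fun j k s => Y j k (φ s)) i n t = bilinOn 𝕊 ε₀ α X Y i n (φ t) :=
  rfl

/-- The time-reversed, sign-flipped background `Ψ_{j,k}(t) = −Φ_{j,k}(−t)` turns the backward equation into a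
forward one: `linField_Ψ(−t) V = −linField_Φ(t) V`. [cite: Tao2016AveragedNS, §4 (4.8)] -/
theorem linField_reverse (𝕊 : Finset (ℤ × ℤ × ℤ)) (α : Fin m → Fin m → Fin m → ℤ × ℤ × ℤ → ℝ)
    {Φ : Fin m → ℤ → ℝ → ℝ} {M : ℝ} (hΦ : ∀ j k t, |Φ j k t| ≤ M)
    (hΨ : ∀ j k t, |(fun j k t => -Φ j k (-t)) j k t| ≤ M) (t : ℝ) (V : Fin m × ℤ →ᵇ ℝ) :
    linField 𝕊 α hΨ (-t) V = -linField 𝕊 α hΦ t V := by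
  ext ⟨i, k⟩
  rw [BoundedContinuousFunction.coe_neg, Pi.neg_apply, linField_apply, linField_apply]
  have e1 : linTermOn 𝕊 0 α (fun j k t => -Φ j k (-t)) (famOf V) i k (-t) =
      linTermOn 𝕊 0 α ((-1 : ℝ) • Φ) (famOf V) i k t := by
    unfold linTermOn
    have h1 := bilinOn_comp_time 𝕊 0 α ((-1 : ℝ) • Φ) (famOf V) (fun s => -s) i k (-t)
    have h2 := bilinOn_comp_time 𝕊 0 α (famOf V) ((-1 : ℝ) • Φ) (fun s => -s) i k (-t)
    simp only [neg_neg, Pi.smul_apply, smul_eq_mul, neg_mul, one_mul] at h1 h2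
    rw [← h1, ← h2]
    rfl
  rw [e1]
  unfold linTermOn
  rw [bilinOn_smul_left, bilinOn_smul_right]
  ring

/-- **GLOBAL EXISTENCE for the linearised lattice equation from bounded data** (scale ratio `1`, any shift set
and table): for a background bounded by `M ≥ 0` and uniformly `Λ`-Lipschitz in time, and a bounded datum `v`
(`|v| ≤ B`), there is a family `u` with `u(0) = v`, solving `u̇_{i,n} = Lin_Φ(u)_{i,n}` at EVERY time
(`HasDerivAt`), and bounded by `B·exp(2‖α‖₁M·T)` on `[−T, T]`.
[cite: Teschl2012, Cor. 2.16 (global existence); Tao2016AveragedNS, §4 (4.8)] -/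
theorem exists_linearised_solution (𝕊 : Finset (ℤ × ℤ × ℤ))
    (α : Fin m → Fin m → Fin m → ℤ × ℤ × ℤ → ℝ) {Φ : Fin m → ℤ → ℝ → ℝ} {M Λ B : ℝ}
    (hΦ : ∀ j k t, |Φ j k t| ≤ M) (hM : 0 ≤ M) (hΛ : 0 ≤ Λ)
    (hlip : ∀ j k t s, |Φ j k t - Φ j k s| ≤ Λ * |t - s|) {v : Fin m → ℤ → ℝ} (hv : ∀ i k, |v i k| ≤ B) :
    ∃ u : Fin m → ℤ → ℝ → ℝ, (∀ i k, u i k 0 = v i k) ∧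
      (∀ i k t, HasDerivAt (u i k) (linTermOn 𝕊 0 α Φ u i k t) t) ∧
      ∀ T : ℝ, 0 ≤ T → ∀ i k, ∀ t ∈ Icc (-T) T, |u i k t| ≤ B * Real.exp (2 * tableAbsSum 𝕊 α * M * T) := by
  set L : ℝ := 2 * tableAbsSum 𝕊 α * M with hL
  have hL0 : 0 ≤ L := by rw [hL]; have := tableAbsSum_nonneg 𝕊 α; positivity
  set U₀ : Fin m × ℤ →ᵇ ℝ := BoundedContinuousFunction.ofNormedAddCommGroupDiscrete (fun p => v p.1 p.2) B
      (fun p => by rw [Real.norm_eq_abs]; exact hv p.1 p.2) with hU₀def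
  have hU₀ : ∀ i k, U₀ (i, k) = v i k := fun i k => rfl
  set Ψ : Fin m → ℤ → ℝ → ℝ := fun j k t => -Φ j k (-t) with hΨ
  have hΨb : ∀ j k t, |(fun j k t => -Φ j k (-t)) j k t| ≤ M := fun j k t => by
    simp only [abs_neg]; exact hΦ j k (-t)
  have hΨlip : ∀ j k t s, |(fun j k t => -Φ j k (-t)) j k t - (fun j k t => -Φ j k (-t)) j k s| ≤ Λ * |t - s| := by
    intro j k t s
    have h := hlip j k (-t) (-s)
    have e1 : |(-Φ j k (-t)) - (-Φ j k (-s))| = |Φ j k (-t) - Φ j k (-s)| := by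
      rw [show (-Φ j k (-t)) - (-Φ j k (-s)) = -(Φ j k (-t) - Φ j k (-s)) by ring, abs_neg]
    have e2 : |(-t) - (-s)| = |t - s| := by rw [show (-t) - (-s) = -(t - s) by ring, abs_neg]
    simp only
    rw [e1]; rw [e2] at h; exact h
  obtain ⟨Uf, hUf0, -, hUfw, hUfd, hUfb⟩ := exists_forward 𝕊 α hΦ hM hΛ hlip U₀
  obtain ⟨W, hW0, -, hWw, hWd, hWb⟩ := exists_forward 𝕊 α hΨb hM hΛ hΨlip U₀
  set U : ℝ → (Fin m × ℤ →ᵇ ℝ) := fun t => if 0 ≤ t then Uf t else W (-t) with hUdef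
  have hUpos : ∀ t, 0 ≤ t → U t = Uf t := fun t ht => by simp only [hUdef, if_pos ht]
  have hUneg : ∀ t, t ≤ 0 → U t = W (-t) := by
    intro t ht
    rcases lt_or_eq_of_le ht with h | h
    · simp only [hUdef, if_neg (not_le.2 h)]
    · subst h; simp only [hUdef, le_refl, if_true, neg_zero, hUf0, hW0]
  have hrev : ∀ t, -(linField 𝕊 α hΨb (-t) (W (-t))) = linField 𝕊 α hΦ t (W (-t)) := by
    intro t
    rw [linField_reverse 𝕊 α hΦ hΨb t (W (-t)), neg_neg]
  have hderU : ∀ t, HasDerivAt U (linField 𝕊 α hΦ t (U t)) t := by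
    intro t
    rcases lt_trichotomy t 0 with ht | ht | ht
    · have hcomp : HasDerivAt (fun s => W (-s)) (-(linField 𝕊 α hΨb (-t) (W (-t)))) t := by
        have h := (hWd (-t) (by linarith)).scomp t (hasDerivAt_neg t)
        simpa [Function.comp_def] using h
      rw [hrev t] at hcomp
      have hev : U =ᶠ[𝓝 t] fun s => W (-s) := by
        filter_upwards [Iio_mem_nhds ht] with s hs
        exact hUneg s hs.le
      rw [hUneg t ht.le]
      exact hcomp.congr_of_eventuallyEq hev
    · subst ht
      have hr : HasDerivWithinAt U (linField 𝕊 α hΦ 0 (U 0)) (Ici 0) 0 := by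
        rw [hUpos 0 le_rfl]
        exact (hUfw 0 le_rfl).congr_of_mem (fun s hs => hUpos s hs) self_mem_Ici
      have hl : HasDerivWithinAt U (linField 𝕊 α hΦ 0 (U 0)) (Iic 0) 0 := by
        have hcomp : HasDerivWithinAt (fun s => W (-s)) (-(linField 𝕊 α hΨb 0 (W 0))) (Iic 0) 0 := by
          have h1 := (hWw 0 le_rfl)
          rw [show (0 : ℝ) = -0 by simp] at h1
          have h2 := h1.scomp (0 : ℝ) ((hasDerivAt_neg (0 : ℝ)).hasDerivWithinAt)
            (fun s (hs : s ∈ Iic (0 : ℝ)) => show -s ∈ Ici (-0 : ℝ) by simpa using hs)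
          simpa [Function.comp_def] using h2
        have e : -(linField 𝕊 α hΨb 0 (W 0)) = linField 𝕊 α hΦ 0 (U 0) := by
          have := hrev 0; rw [neg_zero] at this; rw [this, hUneg 0 le_rfl, neg_zero]
        rw [e] at hcomp
        exact hcomp.congr_of_mem (fun s hs => hUneg s hs) self_mem_Iic
      have hu := hl.union hr
      rw [Iic_union_Ici] at hu
      exact hu.hasDerivAt Filter.univ_mem
    · have hev : U =ᶠ[𝓝 t] Uf := by
        filter_upwards [Ioi_mem_nhds ht] with s hs
        exact hUpos s hs.le
      rw [hUpos t ht.le]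
      exact (hUfd t ht).congr_of_eventuallyEq hev
  refine ⟨fun i k t => U t (i, k), fun i k => ?_, fun i k t => ?_, fun T hT i k t ht => ?_⟩
  · show U 0 (i, k) = v i k
    rw [hUpos 0 le_rfl, hUf0]
    exact hU₀ i k
  · have h0 := ((BoundedContinuousFunction.evalCLM ℝ (i, k) :
        (Fin m × ℤ →ᵇ ℝ) →L[ℝ] ℝ).hasFDerivAt).comp_hasDerivAt t (hderU t)
    have h1 : HasDerivAt (fun s => U s (i, k)) (linField 𝕊 α hΦ t (U t) (i, k)) t := by
      simpa [Function.comp_def] using h0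
    rw [linField_apply] at h1
    have e : linTermOn 𝕊 0 α Φ (famOf (U t)) i k t = linTermOn 𝕊 0 α Φ (fun j l s => U s (j, l)) i k t := by
      unfold linTermOn
      rw [MirrorPulse.bilinOn_congr_time 𝕊 0 α (X := Φ) (X' := Φ) (Y := famOf (U t))
          (Y' := fun j l s => U s (j, l)) (t := t) (fun _ _ => rfl) (fun _ _ => rfl) i k,
        MirrorPulse.bilinOn_congr_time 𝕊 0 α (X := famOf (U t)) (X' := fun j l s => U s (j, l))
          (Y := Φ) (Y' := Φ) (t := t) (fun _ _ => rfl) (fun _ _ => rfl) i k]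
    rw [e] at h1
    exact h1
  · have hB0 : 0 ≤ B := (abs_nonneg _).trans (hv i k)
    have hU₀n : ‖U₀‖ ≤ B := (BoundedContinuousFunction.norm_le hB0).2 fun p => by
      rw [Real.norm_eq_abs]; exact hv p.1 p.2
    have hcoord : |U t (i, k)| ≤ ‖U t‖ := (Real.norm_eq_abs _).symm.le.trans ((U t).norm_coe_le_norm (i, k))
    show |U t (i, k)| ≤ B * Real.exp (L * T)
    refine hcoord.trans ?_
    rcases le_or_gt 0 t with h0t | ht0
    · rw [hUpos t h0t]
      have h := hUfb t h0t
      have hmono : Real.exp (L * t) ≤ Real.exp (L * T) := Real.exp_le_exp.2 (by nlinarith [ht.2])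
      calc ‖Uf t‖ ≤ ‖U₀‖ * Real.exp (L * t) := h
        _ ≤ B * Real.exp (L * T) := mul_le_mul hU₀n hmono (Real.exp_pos _).le hB0
    · rw [hUneg t ht0.le]
      have h := hWb (-t) (by linarith)
      have hmono : Real.exp (L * (-t)) ≤ Real.exp (L * T) := Real.exp_le_exp.2 (by nlinarith [ht.1])
      calc ‖W (-t)‖ ≤ ‖U₀‖ * Real.exp (L * (-t)) := h
        _ ≤ B * Real.exp (L * T) := mul_le_mul hU₀n hmono (Real.exp_pos _).le hB0

end QuadPolar

namespace MirrorPulse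

/-- A bounded global solution of the λ₀ = 1 mirror lattice is uniformly Lipschitz in time at every site:
`|Φ_{j,k}(t) − Φ_{j,k}(s)| ≤ 5M² |t − s|` when `|Φ| ≤ M` and `|ε| ≤ ½` (mean value inequality with
`|Φ̇| = |Q(Φ)| ≤ (3 + 4|ε|)M² ≤ 5M²`). [cite: Tao2016AveragedNS, §4 (4.8); route TaoLadderRungTwoFlat, λ₀ = 1 layer] -/
theorem IsGlobalSol.lipschitz_time {ε : ℝ} {Φ : Fin 2 → ℤ → ℝ → ℝ} {M : ℝ} (hΦ : IsGlobalSol ε Φ)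
    (hM : ∀ j k t, |Φ j k t| ≤ M) (hε : |ε| ≤ 1 / 2) (j : Fin 2) (k : ℤ) (t s : ℝ) :
    |Φ j k t - Φ j k s| ≤ 5 * M ^ 2 * |t - s| := by
  have hbound : ∀ x ∈ (univ : Set ℝ), ‖quadTermOn shiftSetFlat 0 (mirrorTable ε ε) Φ j k x‖ ≤ 5 * M ^ 2 := by
    intro x _
    rw [Real.norm_eq_abs]
    have h := abs_quadTermOn_mirror_zero_le ε ε (fun j' k' => hM j' k' x) j k
    have hM2 : 0 ≤ M ^ 2 := sq_nonneg M
    nlinarith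
  have h := Convex.norm_image_sub_le_of_norm_hasDerivWithin_le (f := Φ j k) (s := univ)
    (fun x _ => (hΦ j k x).hasDerivWithinAt) hbound convex_univ (mem_univ s) (mem_univ t)
  simpa [Real.norm_eq_abs] using h

/-- **THE VARIATIONAL SOLUTION OPERATOR EXISTS**: along a bounded global solution `Φ` of the homogeneous mirror
lattice (`|ε| ≤ ½`), every bounded datum `v` launches a variational solution `u` with `u(0) = v` that lies
in `IsVariationalOn ε T Φ ·` for every horizon `T` (with `…LinearisedUniqueness`: it is unique there).
[cite: Teschl2012, Cor. 2.16; Tao2016AveragedNS, §4 (4.8); route TaoLadderRungTwoFlat, λ₀ = 1 layer (S2)] -/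
theorem exists_isVariationalOn {ε : ℝ} {Φ : Fin 2 → ℤ → ℝ → ℝ} (hΦ : IsGlobalSol ε Φ) (hb : IsBddFam Φ)
    (hε : |ε| ≤ 1 / 2) {v : Fin 2 → ℤ → ℝ} {B : ℝ} (hv : ∀ i k, |v i k| ≤ B) :
    ∃ u : Fin 2 → ℤ → ℝ → ℝ, (∀ i k, u i k 0 = v i k) ∧ ∀ T : ℝ, IsVariationalOn ε T Φ u := by
  obtain ⟨M, hM⟩ := hb
  have hM0 : 0 ≤ M := (abs_nonneg _).trans (hM 0 0 0)
  obtain ⟨u, hu0, hder, hbdd⟩ := QuadPolar.exists_linearised_solution shiftSetFlat (mirrorTable ε ε) hM hM0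
    (by positivity : (0 : ℝ) ≤ 5 * M ^ 2) (hΦ.lipschitz_time hM hε) hv
  refine ⟨u, hu0, fun T => ⟨hder, ?_⟩⟩
  refine ⟨B * Real.exp (2 * QuadPolar.tableAbsSum shiftSetFlat (mirrorTable ε ε) * M * max T 0), fun i n t ht => ?_⟩
  exact hbdd (max T 0) (le_max_right _ _) i n t ⟨by linarith [ht.1, le_max_right T 0], ht.2.trans (le_max_left _ _)⟩

end MirrorPulse

end Summit.NavierStokesRegularity.NavierStokesRegularity.Theorems

end
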